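import Literature.IUT.HodgeTheaters.InitialThetaDataTorsionClaimsModelKLevel
import HarnessLib

/-!
# [IUTchI] Def 3.1 (b)(d)(f) / Def 6.1 (v): the embedding `Π_{C_K} ↪ Π_{C_F}`, the assembled `ThetaGeometry`, the
# re-geometrised initial Θ-datum `regeom₂` of the semidirect CLAIMS MODEL and its `l`-torsion monodromy term
# (JOINT NV witness «{TorsionMonodromy, ArrowCoveringClaims, hI}», part 3: the geometry and the monodromy)

S. Mochizuki, *Inter-universal Teichmüller theory I*, kurims manuscript (May 2020), §3 Definition 3.1 (d) p. 62
«`C̲_K` is a hyperbolic orbicurve of type `(1, l-tors)±` … over `K`, with `K`-core `C_K := C_F ×_F K` … determines,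
up to `K`-isomorphism, a hyperbolic orbicurve `X̲_K` of type `(1, l-tors)`», §6 Definition 6.1 (v) p. 158 «the Galois
action on `Δ_X^{ab} ⊗ 𝔽_l`», «the rank one quotient of `Δ_X^{ab} ⊗ 𝔽_l` that gives rise to the covering `X̲_K → X_K`»
([IUTchI] Def 3.1 (d) p.62, Def 6.1 (v) p.158) [claim: Mochizuki2012, status: disputed] (D-0012 claim key; series
status DISPUTED — a MODEL of the cell's `π₁`-interface structures; nothing of the series is asserted; no side taken on
[IUTchIII] Cor. 3.12).

## WHAT (continuing `…ClaimsModel.lean` / `…ClaimsModelKLevel.lean`; pattern of abc-iut-L5-t8's `…ModelGeometry.lean`)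

* `embK : Π_{C_K} = G_K × (N ⋊ {±1}) ↪ Π_{C_F} = N ⋊ (G_F × {±1})`, `(σ, ⟨n, u⟩) ↦ ⟨n, (σ, u)⟩` (a homomorphism
  because `G_K` fixes `E_F[l]` and everything fixes the inertia line); injective, continuous, image `aug⁻¹(G_K)`;
* `geometryOf K E l …` — every field of abc-iut-L5-t2's `ThetaGeometry` holds (degrees `l`, `2`; `Π_{X_K} = Π_{X_F} ∩
  Π_{C_K}`; `C̲_K` not over `X_K`);
* `InitialThetaData.regeom₂ D₀` — `D₀` with `geom` replaced by this model (all arithmetic fields (a)–(c), (e) kept,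
  the model's hypotheses discharged from `D₀` exactly as for abc-iut-L5-t8's `regeom`);
* `InitialThetaData.torsionMonodromyRegeom₂ D₀ : D₀.regeom₂.TorsionMonodromy` — `τ ⟨(w, t), (σ, u)⟩ := t` (kills the
  inertia line), `gen := g` (abc-iut-L5-t8's `lineGen`), `Π_{X̲_K}` cut out by `τ ∈ ℤ·gen`.
Proof-only sequel `…ClaimsModelProofs.lean`: the §1 construction at the model, `ArrowCoveringClaims`, `hI`, the JOINT
witness `∃ M, ArrowCoveringClaims ∧ hI`.

HONEST LABEL.  A MODEL (joint non-vacuity evidence), not the genuine `π₁`: finite `Δ_X`, synthetic cusp labels and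
inertia line; only the `l`-torsion with its Galois action and sign is the curve's.  `regeom₂` keeps `D₀`'s ARITHMETIC
(so Def 3.1 (a)(b)(c)(e) hold genuinely) — its `geom` is the model.  No instances beyond part 1's model types.
Instantiated ≠ endorsed; typed ≠ proved; no side taken on [IUTchIII] Cor. 3.12.
-/

noncomputable section

namespace Literature.IUT.HodgeTheaters

universe u

namespace TorsionClaimsModel

open Literature.AnabelianGeometry.AbsoluteAnabelian Topology
open Literature.AnabelianGeometry.EtaleTheta.SettingModel
open TorsionMonodromyModel
open scoped WeierstrassCurve.Affine Classical

/-! ## Two more pieces of the finite factor: the inertia coordinate and the line with the involution -/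

section DihMore

variable {F : Type u} [Field F] (E : WeierstrassCurve F) (Fbar : Type u) [Field Fbar] [Algebra F Fbar] (l : ℕ)

namespace Dih

/-- **The inertia coordinate `d ↦ d.left.1 : Dih → W` is a HOMOMORPHISM** (the action of `{±1}` on the inertia line
`W` is trivial). [cite: Mochizuki2012, IUTchI §1 p.38] -/
def wCoord : Dih E Fbar l →* Multiplicative (ZMod l) where
  toFun d := d.left.1
  map_one' := by
    show (1 : Dih E Fbar l).left.1 = 1
    rw [SemidirectProduct.one_left, Prod.fst_one]
  map_mul' x y := by
    show (x * y).left.1 = x.left.1 * y.left.1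
    rw [SemidirectProduct.mul_left, Prod.fst_mul, sgnN_apply]

/-- [cite: Mochizuki2012, IUTchI §1 p.38] -/
@[simp] theorem wCoord_apply (d : Dih E Fbar l) : wCoord E Fbar l d = d.left.1 := rfl

variable (F) {Fbar l} in
/-- `dLinePM g := (1 × ℤ·g) ⋊ {±1} = dC g ∩ Ker(wCoord)`: the line with the involution but WITHOUT the inertia factor —
the finite factor of the model's `galKer` / `Π_{C→}` (computed in the proof-only sequel). [cite: Mochizuki2012, IUTchI §1 p.38] -/
def dLinePM (g : Tors E Fbar l) : Subgroup (Dih E Fbar l) := dC F E g ⊓ (wCoord E Fbar l).ker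

variable {E Fbar l}

/-- [cite: Mochizuki2012, IUTchI §1 p.38] -/
theorem mem_dLinePM_iff (g : Tors E Fbar l) (x : Dih E Fbar l) :
    x ∈ dLinePM F E g ↔ x.left.2 ∈ Subgroup.zpowers g ∧ x.left.1 = 1 := Iff.rfl

/-- `dLine g = dXbar g ∩ Ker(wCoord)`. [cite: Mochizuki2012, IUTchI §1 p.38] -/
theorem dLine_eq_inf (g : Tors E Fbar l) : dLine F E g = dXbar F E g ⊓ (wCoord E Fbar l).ker := by
  ext x
  constructor
  · rintro ⟨h1, h2, h3⟩
    exact ⟨⟨h1, h3⟩, h2⟩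
  · rintro ⟨⟨h1, h3⟩, h2⟩
    exact ⟨h1, h2, h3⟩

/-- `dLine g = dLinePM g ∩ dX`. [cite: Mochizuki2012, IUTchI §1 p.38] -/
theorem dLine_eq_dLinePM_inf (g : Tors E Fbar l) : dLine F E g = dLinePM F E g ⊓ dX F E := by
  ext x
  constructor
  · rintro ⟨h1, h2, h3⟩
    exact ⟨⟨h3, h2⟩, h1⟩
  · rintro ⟨⟨h3, h2⟩, h1⟩
    exact ⟨h1, h2, h3⟩

/-- `dLine g ≤ dLinePM g ≤ dC g`. [cite: Mochizuki2012, IUTchI §1 p.38] -/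
theorem dLinePM_le_dC (g : Tors E Fbar l) : dLinePM F E g ≤ dC F E g := inf_le_left

/-- [cite: Mochizuki2012, IUTchI §1 p.38] -/
theorem dLine_le_dLinePM (g : Tors E Fbar l) : dLine F E g ≤ dLinePM F E g := fun _ hx => ⟨hx.2.2, hx.2.1⟩

/-- `#((1 × ℤ·g) ⋊ {±1}) = l·2`. [cite: Mochizuki2012, IUTchI §1 p.38] -/
theorem card_dLinePM (hl : l.Prime) {g : Tors E Fbar l} (hg : g ≠ 1) : Nat.card ↥(dLinePM F E g) = l * 2 := by
  let e : ↥(dLinePM F E g) ≃ ↥(Subgroup.zpowers g) × ℤˣ :=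
    { toFun := fun x => (⟨x.1.left.2, x.2.1⟩, x.1.right)
      invFun := fun p => ⟨⟨(1, (p.1 : Tors E Fbar l)), p.2⟩, p.1.2, rfl⟩
      left_inv := fun x => Subtype.ext (SemidirectProduct.ext (Prod.ext x.2.2.symm rfl) rfl)
      right_inv := fun p => Prod.ext (Subtype.ext rfl) rfl }
  rw [Nat.card_congr e, Nat.card_prod, Tors.card_zpowers hl hg, Nat.card_eq_fintype_card (α := ℤˣ),
    Fintype.card_units_int]

variable [E.IsElliptic] [NeZero l]

/-- `[dC g : dLinePM g] = l` (= `[Π_{C̲_K} : Π_{C→_K}]` at the model). [cite: Mochizuki2012, IUTchI §1 p.38] -/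
theorem dLinePM_relIndex_dC (hl : l.Prime) (hcard : Nat.card (Tors E Fbar l) = l ^ 2) {g : Tors E Fbar l}
    (hg : g ≠ 1) : (dLinePM F E g).relIndex (dC F E g) = l := by
  have hL : (dLinePM F E g).index = l * l := by
    have h := Subgroup.card_mul_index (dLinePM F E g)
    rw [card_dLinePM hl hg, card, hcard] at h
    have h' : l * 2 * (dLinePM F E g).index = l * 2 * (l * l) := by rw [h]; ring
    exact Nat.eq_of_mul_eq_mul_left (Nat.mul_pos hl.pos two_pos) h'
  have h := Subgroup.relIndex_mul_index (dLinePM_le_dC (F := F) (E := E) g)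
  rw [hL, dC_index hl hcard hg] at h
  have h' : (dLinePM F E g).relIndex (dC F E g) * l = l * l := by rw [h]
  exact Nat.eq_of_mul_eq_mul_right hl.pos h'

/-- `[dC g : dLine g] = 2l` (= `[Π_{C̲_K} : Π_{X→_K}]` at the model). [cite: Mochizuki2012, IUTchI §1 p.38] -/
theorem dLine_relIndex_dC (hl : l.Prime) (hcard : Nat.card (Tors E Fbar l) = l ^ 2) {g : Tors E Fbar l}
    (hg : g ≠ 1) : (dLine F E g).relIndex (dC F E g) = 2 * l := by
  have hL : (dLine F E g).index = l * l * 2 := by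
    have h := Subgroup.card_mul_index (dLine F E g)
    rw [card_dLine hl hg, card, hcard] at h
    have h' : l * (dLine F E g).index = l * (l * l * 2) := by rw [h]; ring
    exact Nat.eq_of_mul_eq_mul_left hl.pos h'
  have h := Subgroup.relIndex_mul_index ((dLine_le_dLinePM (F := F) (E := E) g).trans (dLinePM_le_dC g))
  rw [hL, dC_index hl hcard hg] at h
  have h' : (dLine F E g).relIndex (dC F E g) * l = 2 * l * l := by rw [h]; ring
  exact Nat.eq_of_mul_eq_mul_right hl.pos h'

end Dih

end DihMore

/-! ## The embedding `Π_{C_K} ↪ Π_{C_F}` and the assembled `ThetaGeometry` -/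

section Geometry

variable {F : Type u} (K : Type u) {Fbar : Type u} [Field F] [Field K] [Field Fbar] [Algebra F Fbar]
  [Algebra K Fbar] (E : WeierstrassCurve F) (l : ℕ)

variable {K E l}

/-- `σ ∈ G_F` fixing the `l`-torsion acts on `N` through its sign only. [cite: Mochizuki2012, IUTchI Def 3.1 (c) p.62] -/
theorem actN_eq_of_fixesTorsion {σ : Fbar ≃ₐ[F] Fbar} (hσ : FixesTorsion E l σ) (u : ℤˣ) (n : N E Fbar l) :
    actN F E Fbar l (σ, u) n = actN F E Fbar l (1, u) n := by
  refine Prod.ext rfl ?_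
  show act F E Fbar l (σ, u) n.2 = act F E Fbar l (1, u) n.2
  rw [act, MonoidHom.noncommCoprod_apply, MonoidHom.noncommCoprod_apply, MulAut.mul_apply, MulAut.mul_apply,
    map_one, MulAut.one_apply, torsRep_apply_of_fixesTorsion E Fbar l hσ]

/-- **`embK : Π_{C_K} = G_K × (N ⋊ {±1}) ↪ Π_{C_F} = N ⋊ (G_F × {±1})`**, `(σ, ⟨n, u⟩) ↦ ⟨n, (σ, u)⟩` — a HOMOMORPHISM
because `G_K` acts trivially on `E_F[l](F̄)` (`hK`, Def 3.1 (c)) and on the inertia line. [cite: Mochizuki2012, IUTchI Def 3.1 (d) p.62] -/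
def embK (hK : ∀ σ ∈ galoisSubgroupOf F K Fbar, FixesTorsion E l σ) :
    (galoisSubgroupOf F K Fbar × Dih E Fbar l) →* PiC F E Fbar l where
  toFun x := ⟨x.2.left, ((x.1 : Fbar ≃ₐ[F] Fbar), x.2.right)⟩
  map_one' := rfl
  map_mul' x y := by
    refine SemidirectProduct.ext ?_ rfl
    show x.2.left * sgnN E Fbar l x.2.right y.2.left =
      x.2.left * actN F E Fbar l ((x.1 : Fbar ≃ₐ[F] Fbar), x.2.right) y.2.left
    rw [actN_eq_of_fixesTorsion (hK _ x.1.2)]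
    rfl

/-- [cite: Mochizuki2012, IUTchI Def 3.1 (d) p.62] -/
@[simp] theorem embK_left (hK : ∀ σ ∈ galoisSubgroupOf F K Fbar, FixesTorsion E l σ)
    (x : galoisSubgroupOf F K Fbar × Dih E Fbar l) : (embK hK x).left = x.2.left := rfl

/-- [cite: Mochizuki2012, IUTchI Def 3.1 (d) p.62] -/
@[simp] theorem embK_right (hK : ∀ σ ∈ galoisSubgroupOf F K Fbar, FixesTorsion E l σ)
    (x : galoisSubgroupOf F K Fbar × Dih E Fbar l) : (embK hK x).right = ((x.1 : Fbar ≃ₐ[F] Fbar), x.2.right) := rfl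

/-- `embK` is injective. [cite: Mochizuki2012, IUTchI Def 3.1 (d) p.62] -/
theorem embK_injective (hK : ∀ σ ∈ galoisSubgroupOf F K Fbar, FixesTorsion E l σ) :
    Function.Injective (embK hK) := by
  rintro ⟨a, b⟩ ⟨a', b'⟩ h
  have h1 := congrArg SemidirectProduct.left h
  have h2 := congrArg SemidirectProduct.right h
  simp only [embK_left, embK_right, Prod.mk.injEq] at h1 h2
  exact Prod.ext (Subtype.ext h2.1) (SemidirectProduct.ext h1 h2.2)

/-- `x ∈ Im(embK) ↔ aug x ∈ G_K`. [cite: Mochizuki2012, IUTchI Def 3.1 (d) p.62] -/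
theorem mem_range_embK_iff (hK : ∀ σ ∈ galoisSubgroupOf F K Fbar, FixesTorsion E l σ) (x : PiC F E Fbar l) :
    x ∈ (embK hK).range ↔ x.right.1 ∈ galoisSubgroupOf F K Fbar := by
  constructor
  · rintro ⟨y, rfl⟩
    exact y.1.2
  · intro hx
    exact ⟨(⟨x.right.1, hx⟩, ⟨x.left, x.right.2⟩), SemidirectProduct.ext rfl (Prod.ext rfl rfl)⟩

/-- `embK` is continuous. [cite: Mochizuki2012, IUTchI Def 3.1 (d) p.62] -/
theorem embK_continuous (hK : ∀ σ ∈ galoisSubgroupOf F K Fbar, FixesTorsion E l σ) : Continuous (embK hK) := by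
  refine (Semidirect.continuous_iff_left_right (PiC.isInducing E Fbar l)).2 ⟨?_, ?_⟩
  · exact (continuous_of_discreteTopology : Continuous (SemidirectProduct.left : Dih E Fbar l → N E Fbar l)).comp
      continuous_snd
  · exact (continuous_subtype_val.comp continuous_fst).prodMk
      ((continuous_of_discreteTopology : Continuous (SemidirectProduct.right : Dih E Fbar l → ℤˣ)).comp continuous_snd)

variable (K E l) in
/-- **The claims model of the `π₁`-interface of [IUTchI] Def 3.1 (b)(d)(f)** for `G_F ⊇ G_K` with `G_K` acting
trivially on `E_F[l](F̄)` (`hK`), `l ≥ 5` prime, `#E_F[l](F̄) = l²` (`hcard`) and a generator `g ≠ 1` of the line: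
`Π_{C_F} := N ⋊ (G_F × {±1})`, `Π_{X_F} = N ⋊ (G_F × 1)`, `Π_{C_K} = G_K × (N ⋊ {±1})` embedded by `embK`,
`Π_{X̲_K} = G_K × ((W × ℤ·g) ⋊ 1)`, cusp inertia `W`.  Every field of `ThetaGeometry` holds.
[cite: Mochizuki2012, IUTchI Def 3.1 p.61–63] -/
def geometryOf [Algebra F K] [IsScalarTower F K Fbar] [IsGalois F Fbar] [E.IsElliptic]
    (hK : ∀ σ ∈ galoisSubgroupOf F K Fbar, FixesTorsion E l σ) (hl : l.Prime) (h5 : 5 ≤ l)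
    (hcard : Nat.card (Tors E Fbar l) = l ^ 2) (g : Tors E Fbar l) (hg : g ≠ 1) :
    ThetaGeometry (Fbar ≃ₐ[F] Fbar) (galoisSubgroupOf F K Fbar) l :=
  haveI : NeZero l := ⟨hl.ne_zero⟩
  letI : CompactSpace (galoisSubgroupOf F K Fbar) :=
    isCompact_iff_compactSpace.mp (ThetaGeometryModel.isClosed_galoisSubgroupOf F K Fbar).isCompact
  { extF := ext F E Fbar l
    galIso := MulEquiv.refl _
    galIso_continuous := ⟨continuous_id, continuous_id⟩
    PiX := PiX F E Fbar l
    PiX_isOpen := PiX_isOpen E Fbar l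
    PiX_normal := PiX_normal E Fbar l
    PiX_index := PiX_index E Fbar l
    aug_PiX := by
      rw [eq_top_iff]
      intro σ _
      exact ⟨SemidirectProduct.inr (σ, 1), inr_mem_PiX E Fbar l σ, rfl⟩
    pe := pedOf (galoisSubgroupOf F K Fbar) g h5 (coprime_six_of_prime l hl h5)
    pe_l := rfl
    embK := embK hK
    embK_continuous := embK_continuous hK
    embK_injective := embK_injective hK
    embK_range := by
      ext x
      exact mem_range_embK_iff hK x
    galKIso := MulEquiv.refl _
    aug_compat := fun _ => rfl
    embK_PiX := by
      ext x
      constructor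
      · rintro ⟨y, hy, rfl⟩
        exact ⟨(mem_PiX_iff E Fbar l _).mpr ((Dih.mem_dX_iff _).mp (mem_lift.mp hy)), y, rfl⟩
      · rintro ⟨hx, y, rfl⟩
        exact ⟨y, mem_lift.mpr ((Dih.mem_dX_iff _).mpr ((mem_PiX_iff E Fbar l _).mp hx)), rfl⟩
    PiXbar_relIndex := by
      rw [pedOf_PiXbar]
      show (lift _ (Dih.dXbar F E g)).relIndex (lift _ (Dih.dX F E)) = l
      rw [lift_relIndex, Dih.dXbar_relIndex_dX hl hcard hg]
    aug_PiXbar := by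
      rw [pedOf_PiXbar]
      exact fst_lift_surjective _ _
    PiXbar_relIndex_PiCbar := by
      rw [pedOf_PiXbar]
      show (lift _ (Dih.dXbar F E g)).relIndex (lift _ (Dih.dC F E g)) = 2
      rw [lift_relIndex, Dih.dXbar_relIndex_dC hl hcard hg]
    not_PiCbar_le_PiX := by
      intro h
      apply Dih.not_dC_le_dX (F := F) (E := E) g
      intro d hd
      exact h (show ((1 : galoisSubgroupOf F K Fbar), d) ∈ lift _ (Dih.dC F E g) from hd) }

/-- The cocycle identity of the model on `Π_{X_F}` in the `E_F[l]`-coordinate, on points: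
`(gh).left.2 = g.left.2 · σ_g(h.left.2)`. [cite: Mochizuki2012, IUTchI Def 6.1 (v) p.158] -/
theorem pt_left_snd_mul_of_right_snd_eq_one {g : PiC F E Fbar l} (hg : g.right.2 = 1) (h : PiC F E Fbar l) :
    Tors.pt (g * h).left.2 = Tors.pt g.left.2 + galoisAct E g.right.1 (Tors.pt h.left.2) := by
  rw [SemidirectProduct.mul_left, Prod.snd_mul, Tors.pt_mul, actN_apply_snd, pt_act, hg, Units.val_one, one_smul]

end Geometry

end TorsionClaimsModel

/-! ## The re-geometrised initial Θ-datum `regeom₂` and its `TorsionMonodromy` term -/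

namespace InitialThetaData

open TorsionMonodromyModel TorsionClaimsModel
open scoped WeierstrassCurve.Affine Classical

variable {F K Fbar : Type u} [Field F] [NumberField F] [Field K] [NumberField K] [Algebra F K] [Field Fbar]
  [Algebra F Fbar] [Algebra K Fbar] {E : WeierstrassCurve F} [E.IsElliptic] {l : ℕ} {Pb : BadPlacePredicates K}

/-- **The re-geometrised initial Θ-datum of the claims model**: `D₀` with its `π₁`-interface field `geom` REPLACED by
`Π_{C_F} := (ℤ/l × E_F[l](F̄)) ⋊ (G_F × {±1})` with nontrivial (synthetic) cusp inertia (all arithmetic fields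
(a)–(c), (e) of Def 3.1 kept; the model's hypotheses discharged from `D₀` as for abc-iut-L5-t8's `regeom`).
[cite: Mochizuki2012, IUTchI Def 3.1 p.61–63] -/
def regeom₂ (D₀ : InitialThetaData F K Fbar E l Pb) : InitialThetaData F K Fbar E l Pb :=
  haveI := D₀.isAlgClosure
  haveI := D₀.isScalarTower
  { D₀ with
    geom := TorsionClaimsModel.geometryOf K E l D₀.fixesTorsion_of_mem_galoisSubgroupOf D₀.l_prime D₀.five_le_l
      D₀.card_tors_eq D₀.lineGen D₀.lineGen_ne_one }

/-- **The `l`-TORSION MONODROMY TERM of `regeom₂`**: `τ ⟨(w, t), (σ, u)⟩ := t ∈ E_F[l](F̄)` (kills the inertia line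
`W`), `gen := g`, and `Π_{X̲_K} = G_K × ((W × ℤ·g) ⋊ 1)` is cut out by `τ ∈ ℤ·gen`.
[cite: Mochizuki2012, IUTchI Def 6.1 (v) p.158] -/
def torsionMonodromyRegeom₂ (D₀ : InitialThetaData F K Fbar E l Pb) : D₀.regeom₂.TorsionMonodromy :=
  haveI := D₀.isAlgClosure
  haveI := D₀.isScalarTower
  haveI : NeZero l := ⟨D₀.l_prime.ne_zero⟩
  { tau := fun x => Tors.pt (x : TorsionClaimsModel.PiC F E Fbar l).left.2
    tau_torsion := fun g _ => Tors.torsion_pt _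
    tau_mul := fun g hg h _ =>
      pt_left_snd_mul_of_right_snd_eq_one ((TorsionClaimsModel.mem_PiX_iff E Fbar l _).mp hg) h
    tau_surjOn := by
      intro P hP
      refine ⟨(SemidirectProduct.inl (1, Tors.ofPt P hP) : TorsionClaimsModel.PiC F E Fbar l),
        ⟨TorsionClaimsModel.inl_mem_PiX E Fbar l _, ?_⟩, ?_⟩
      · exact (TorsionClaimsModel.mem_geom_ext_iff E Fbar l _).mpr rfl
      · show Tors.pt (SemidirectProduct.inl (1, Tors.ofPt P hP) : TorsionClaimsModel.PiC F E Fbar l).left.2 = P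
        rw [SemidirectProduct.left_inl, Tors.pt_ofPt]
    gen := Tors.pt D₀.lineGen
    gen_torsion := Tors.torsion_pt _
    gen_ne_zero := by
      rw [Ne, Tors.pt_eq_zero_iff]
      exact D₀.lineGen_ne_one
    mem_PiXund_iff := by
      haveI : CompactSpace (galoisSubgroupOf F K Fbar) :=
        isCompact_iff_compactSpace.mp (ThetaGeometryModel.isClosed_galoisSubgroupOf F K Fbar).isCompact
      intro k hk
      obtain ⟨hkX, y, rfl⟩ := hk
      have hy2 : y.2.right = 1 := (TorsionClaimsModel.mem_PiX_iff E Fbar l _).mp hkX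
      change TorsionClaimsModel.embK D₀.fixesTorsion_of_mem_galoisSubgroupOf y ∈
          (TorsionClaimsModel.pedOf (galoisSubgroupOf F K Fbar) D₀.lineGen D₀.five_le_l
            (coprime_six_of_prime l D₀.l_prime D₀.five_le_l)).PiXbar.map
            (TorsionClaimsModel.embK D₀.fixesTorsion_of_mem_galoisSubgroupOf) ↔
        ∃ a : ℤ, Tors.pt (TorsionClaimsModel.embK D₀.fixesTorsion_of_mem_galoisSubgroupOf y).left.2 =
          a • Tors.pt D₀.lineGen
      rw [TorsionClaimsModel.pedOf_PiXbar, TorsionClaimsModel.embK_left]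
      constructor
      · rintro ⟨z, hz, hzy⟩
        obtain rfl : z = y := TorsionClaimsModel.embK_injective _ hzy
        obtain ⟨a, ha⟩ := Subgroup.mem_zpowers_iff.mp
          ((TorsionClaimsModel.Dih.mem_dXbar_iff _ _).mp (TorsionClaimsModel.mem_lift.mp hz)).2
        exact ⟨a, by rw [← ha, Tors.pt_zpow]⟩
      · rintro ⟨a, ha⟩
        refine ⟨y, TorsionClaimsModel.mem_lift.mpr ((TorsionClaimsModel.Dih.mem_dXbar_iff _ _).mpr
          ⟨hy2, Subgroup.mem_zpowers_iff.mpr ⟨a, ?_⟩⟩), rfl⟩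
        exact Tors.pt_injective (by rw [Tors.pt_zpow, ha]) }

end InitialThetaData

end Literature.IUT.HodgeTheaters

end
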